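import Literature.NumberTheory.EllipticCurves.KodairaNeronAdditiveProofs
import Literature.NumberTheory.EllipticCurves.KodairaNeronSplitHenselianProofs
import Mathlib.FieldTheory.IsAlgClosed.Basic
import Mathlib.RingTheory.Valuation.Integral
import HarnessLib

/-!
# Kodaira–Néron over `K_v^nr` at the multiplicative places: `E(K_v^nr)/E₀(K_v^nr)` is finite
# (Silverman *ATAEC* Cor. IV.9.2(d) over the henselian valuation ring of `K_v^nr`)

`Proofs` file (theorems only, no definitions, no named facts) in topic
`NumberTheory/EllipticCurves`, landed for the named fact
`Literature.NumberTheory.EllipticCurves.LFunction_eq_of_isIsogenous` (Knapp, *Elliptic Curves*,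
Thm. 11.67: isogenous elliptic curves over `ℚ` have the same `L`-function), whose reduction in the
tree (`ComplexMultiplicationLFunctionIsogenyProofs` → `HasseWeilAbelianEulerFactorKodairaNeronProofs`)
consumes the **Kodaira–Néron finiteness over `K_v^nr`** — the named fact
`WeierstrassCurve.kodairaNeron_exists_finset_reducesToNonsingular` of `KodairaNeronUnramified`
(Silverman, *AEC*, Cor. VII.6.2 as used in the proof of Thm. VII.7.1: "the quotient group
`E(K^nr)/E₀(K^nr)` is finite from (VII.6.2)") — at the places of *multiplicative* reduction only
(the Frobenius torsion facts `smul_nsmul_torsion_of_hasMultiplicativeReductionAt_of_kodairaNeron_at`).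
The additive places are the tree's `KodairaNeronAdditiveProofs`; this file is its multiplicative
companion:

* `WeierstrassCurve.kodairaNeron_exists_finset_reducesToNonsingular_of_hasMultiplicativeReduction`:
  **the named fact holds for every elliptic curve over `K_v` given by a minimal equation `X` with
  multiplicative reduction** (split or not), in particular
  (`…_of_hasMultiplicativeReductionAt`) for the minimal models `W.localMinimalModel v` of an
  elliptic curve `E/K` at its multiplicative places.

Let `K` be a number field, `v` a finite place, `𝓞_v ⊆ K_v`, `w = |·|_v` the spectral valuation of
`K̄_v`, `K_v^nr = maxUnramified K_v` and `𝒪ⁿʳ` its valuation ring (a henselian discrete valuation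
ring, unramified over `𝓞_v`: `MaxUnramifiedIntegersProofs`), `φ : 𝓞_v → 𝒪ⁿʳ`, `ψ : 𝒪ⁿʳ → 𝒪_w`
the structure maps.

## The proof

Over `K_v^nr` every multiplicative reduction is split, and for split multiplicative reduction
`[E(K) : E₀(K)] = v(Δ)` is finite (Silverman, *ATAEC*, Cor. IV.9.2(d); *AEC* Thm. VII.6.1), which
the tree proves over any henselian discrete valuation ring in the form
`LocalIndex.index_eq_of_tateNormalForm` (`KodairaNeronSplitHenselianProofs`) for the Tate normal
form `y² + xy = x³ + απⁿ` (`WeierstrassCurve.exists_variableChange_eq_tateNormalForm`,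
`SplitMultiplicativeNormalForm`).  Concretely, for the integral minimal model `X₀` over `𝓞_v` and
`J = X₀ ⊗ 𝒪ⁿʳ`:

1. `Δ(J) ∈ 𝔪ⁿʳ`, `c₄(J) ∉ 𝔪ⁿʳ` (multiplicative reduction, transferred along the unramified `φ`);
2. *the node of `J mod 𝔪ⁿʳ` is split* (`exists_splitNode_root_unrIntegers`): the tangent-slope
   quadratic `c₄ T² + a₁c₄ T − (54 b₆ − 3 b₂ b₄ + a₂ c₄)` of Mathlib's
   `HasSplitMultiplicativeReduction` is separable — `a₁²c₄ + 4(54 b₆ − 3 b₂ b₄ + a₂ c₄) = −c₆`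
   (`a₁_sq_mul_c₄_add_four_mul_eq_neg_c₆`) and `c₆` is a unit when `Δ ∈ 𝔪 ∌ c₄`
   (`isUnit_c₆_of_Δ_mem_of_c₄_not_mem`, from `1728 Δ = c₄³ − c₆²`) — so a root `β ∈ K̄_v` of the
   monic quadratic `T² + a₁ T − c₄⁻¹(…)` is integral with `2β + a₁ ∈ 𝒪_w^×`, hence lies in `K_v^nr`
   (`mem_maxUnramified_of_isRoot_map`: its inertia conjugates are congruent roots), and its residue
   in the residue field of `𝒪ⁿʳ` is the required root;
3. hence a Tate normal form `D • J : y² + xy = x³ + απⁿ`, `n ≥ 1`, over the henselian `𝒪ⁿʳ`, and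
   `[J(K_v^nr) : E₀] = n` is finite (`index_nonsingularReductionSubgroup_map_ne_zero_of_multiplicative`);
4. representatives of the finitely many classes are pushed into `X(K̄_v)`; their coordinates lie in
   `K_v^nr`, the fixed field of `I_𝔐`; the `I_𝔐`-fixed points of `X(K̄_v)` come from `X(K_v^nr)`;
   and `E₀` over `𝒪ⁿʳ` maps into `E₀` over `𝒪_w` — steps (2)–(4) of `KodairaNeronAdditiveProofs`,
   verbatim.

## References

* J. H. Silverman, *Advanced Topics in the Arithmetic of Elliptic Curves*, GTM 151 (1994):
  Cor. IV.9.2(d) (PDF p. 340), Thm. IV.9.4 Step 2 (PDF p. 344). [SilvermanATAEC1994]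
* J. H. Silverman, *The Arithmetic of Elliptic Curves*, 2nd ed. (2009): Thm. VII.6.1, Cor. VII.6.2
  and the proof of Thm. VII.7.1 (PDF pp. 177–179); Prop. VII.5.1 (PDF p. 196: `c₄ ∈ R^×` for
  multiplicative reduction). [SilvermanAEC2009]
* A. W. Knapp, *Elliptic Curves*, Math. Notes 40 (1992), Thm. 11.67 (PDF p. 281). [Knapp1993]

## Design

No definitions, no notation; theorems only; `open scoped Classical NNReal`; one universe `u`; the
spectral valuation is quantified with `hw` as in `SelmerFiniteProofs` / `KodairaNeronAdditiveProofs`;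
`K_v`, `K̄_v`, `K_v^nr`, `𝒪ⁿʳ`, `𝓞_v` are spelled out as expressions in the code, as in that file.
`set_option maxHeartbeats` is raised for the main theorem (many coercions), as in the additive file.
-/

noncomputable section

open scoped Classical NNReal
open NumberField IsDedekindDomain Field Polynomial IsLocalRing

universe u

namespace WeierstrassCurve

/-! ## Two identities of a Weierstrass equation with multiplicative reduction -/

/-- The discriminant of the tangent-slope quadratic of a node: for every Weierstrass equation,
`a₁² c₄ + 4 (54 b₆ − 3 b₂ b₄ + a₂ c₄) = −c₆` (so the quadratic
`c₄ T² + a₁ c₄ T − (54 b₆ − 3 b₂ b₄ + a₂ c₄)` of Mathlib's `HasSplitMultiplicativeReduction` has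
discriminant `−c₄ c₆`).  Deliberate dot-notation extension of Mathlib's `WeierstrassCurve`.
[folklore] -/
theorem a₁_sq_mul_c₄_add_four_mul_eq_neg_c₆ {S : Type*} [CommRing S] (W : WeierstrassCurve S) :
    W.a₁ ^ 2 * W.c₄ + 4 * (54 * W.b₆ - 3 * W.b₂ * W.b₄ + W.a₂ * W.c₄) = -W.c₆ := by
  simp only [WeierstrassCurve.b₂, WeierstrassCurve.b₄, WeierstrassCurve.b₆, WeierstrassCurve.c₄,
    WeierstrassCurve.c₆]
  ring

/-- **`c₆` is a unit for multiplicative reduction**: over a local ring, if `Δ ∈ 𝔪` and `c₄ ∉ 𝔪`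
then `c₆ ∉ 𝔪`, since `1728 Δ = c₄³ − c₆²` (Silverman, *AEC*, Prop. VII.5.1(b) and its proof).
Deliberate dot-notation extension of Mathlib's `WeierstrassCurve`.
[cite: SilvermanAEC2009, Prop. VII.5.1 (PDF p. 196)] -/
theorem isUnit_c₆_of_Δ_mem_of_c₄_not_mem {S : Type*} [CommRing S] [IsLocalRing S]
    (W : WeierstrassCurve S) (hΔ : W.Δ ∈ maximalIdeal S) (hc₄ : W.c₄ ∉ maximalIdeal S) :
    IsUnit W.c₆ := by
  have hc₄u : IsUnit W.c₄ := by
    by_contra h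
    exact hc₄ ((IsLocalRing.mem_maximalIdeal _).mpr (mem_nonunits_iff.mpr h))
  have hsq : W.c₆ ^ 2 = W.c₄ ^ 3 - 1728 * W.Δ := by linear_combination W.c_relation
  have hres : residue S (W.c₆ ^ 2) = residue S (W.c₄ ^ 3) := by
    rw [hsq, map_sub, (residue_eq_zero_iff _).mpr (Ideal.mul_mem_left _ _ hΔ), sub_zero]
  apply (residue_ne_zero_iff_isUnit _).mp
  intro h0
  have h3 : residue S (W.c₄ ^ 3) = 0 := by rw [← hres, map_pow, h0, zero_pow two_ne_zero]
  rw [map_pow] at h3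
  exact (residue_ne_zero_iff_isUnit _).mpr hc₄u (pow_eq_zero_iff three_ne_zero |>.mp h3)

end WeierstrassCurve

namespace IsDedekindDomain.HeightOneSpectrum

open Literature.NumberTheory.EllipticCurves Literature.NumberTheory.EllipticCurves.LocalIndex
  Literature.NumberTheory.GaloisRepresentations
  Literature.NumberTheory.GaloisRepresentations.IsNonarchimedeanLocalField
  Literature.NumberTheory.DiophantineGeometry Literature.NumberTheory.DiophantineGeometry.TateAlgorithm

variable {K : Type u} [Field K] [NumberField K] {v : HeightOneSpectrum (𝓞 K)}
  {w : Valuation (AlgebraicClosure (v.adicCompletion K)) ℝ≥0}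
  (hw : ∀ x, (w x : ℝ) = spectralNorm (v.adicCompletion K) (AlgebraicClosure (v.adicCompletion K)) x)


/-! ## The node of a multiplicative equation over `𝒪ⁿʳ` is split -/

include hw in
set_option maxHeartbeats 1600000 in
/-- **Over `𝒪ⁿʳ` the tangent-slope quadratic of a node has a root in the residue field.**  For a
Weierstrass equation `I` over `𝒪ⁿʳ` with `Δ ∈ 𝔪ⁿʳ` and `c₄ ∉ 𝔪ⁿʳ`, the quadratic
`c̄₄ μ² + ā₁ c̄₄ μ − (54 b̄₆ − 3 b̄₂ b̄₄ + ā₂ c̄₄) = 0` of Mathlib's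
`WeierstrassCurve.HasSplitMultiplicativeReduction` is soluble in the residue field of `𝒪ⁿʳ`:
a root `β ∈ K̄_v` of the monic `T² + a₁ T − c₄⁻¹(54 b₆ − 3 b₂ b₄ + a₂ c₄)` is integral, and
`(2β + a₁)² c₄ = −c₆` is a unit (`a₁_sq_mul_c₄_add_four_mul_eq_neg_c₆`,
`isUnit_c₆_of_Δ_mem_of_c₄_not_mem`), so `β` is a simple root modulo `𝔪_w` and lies in `K_v^nr`
(`mem_maxUnramified_of_isRoot_map`; Neukirch, *ANT*, II §6, (9.11): `K_v^nr` is henselian with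
separably closed residue field); its residue is the root.  (Silverman, *AEC*, Prop. VII.5.1 and
Exercise 3.5: the reduction is split over the residue field extension generated by the slopes.)
[cite: NeukirchANT1999, Ch. II (6.6)–(6.8) with Prop. (9.11)] -/
theorem exists_splitNode_root_unrIntegers
    (I : WeierstrassCurve (Valuation.valuationSubring (Valuation.comap (algebraMap (maxUnramified (v.adicCompletion K)) (AlgebraicClosure (v.adicCompletion K))) w))) (hΔ : I.Δ ∈ maximalIdeal (Valuation.valuationSubring (Valuation.comap (algebraMap (maxUnramified (v.adicCompletion K)) (AlgebraicClosure (v.adicCompletion K))) w))) (hc₄ : I.c₄ ∉ maximalIdeal (Valuation.valuationSubring (Valuation.comap (algebraMap (maxUnramified (v.adicCompletion K)) (AlgebraicClosure (v.adicCompletion K))) w))) :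
    ∃ μ : ResidueField (Valuation.valuationSubring (Valuation.comap (algebraMap (maxUnramified (v.adicCompletion K)) (AlgebraicClosure (v.adicCompletion K))) w)), letI Ib := I.map (residue (Valuation.valuationSubring (Valuation.comap (algebraMap (maxUnramified (v.adicCompletion K)) (AlgebraicClosure (v.adicCompletion K))) w)));
      Ib.c₄ * μ ^ 2 + Ib.a₁ * Ib.c₄ * μ - (54 * Ib.b₆ - 3 * Ib.b₂ * Ib.b₄ + Ib.a₂ * Ib.c₄) = 0 := by
  obtain ⟨ψ, hψ⟩ := exists_ringHom_unrIntegers_integer (w := w) (v := v) (K := K)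
  have hvw : w.Integers w.integer := Valuation.integer.integers w
  have hψinj : Function.Injective ψ := injective_of_coe_eq_coe hψ
  have hψmem : ∀ x : (Valuation.valuationSubring (Valuation.comap (algebraMap (maxUnramified (v.adicCompletion K)) (AlgebraicClosure (v.adicCompletion K))) w)), ((ψ x : w.integer) : (AlgebraicClosure (v.adicCompletion K))) ∈ (maxUnramified (v.adicCompletion K)) := fun x ↦ by
    rw [hψ]; exact (x : (maxUnramified (v.adicCompletion K))).2
  -- the units `c₄`, `c₆`
  have hc₄u : IsUnit I.c₄ := by
    by_contra h
    exact hc₄ ((IsLocalRing.mem_maximalIdeal _).mpr (mem_nonunits_iff.mpr h))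
  have hc₆u : IsUnit I.c₆ := I.isUnit_c₆_of_Δ_mem_of_c₄_not_mem hΔ hc₄
  -- the monic quadratic `g = T² + a₁ T + e`, `e = -c₄⁻¹ c`
  set c : (Valuation.valuationSubring (Valuation.comap (algebraMap (maxUnramified (v.adicCompletion K)) (AlgebraicClosure (v.adicCompletion K))) w)) := 54 * I.b₆ - 3 * I.b₂ * I.b₄ + I.a₂ * I.c₄ with hc
  set e : (Valuation.valuationSubring (Valuation.comap (algebraMap (maxUnramified (v.adicCompletion K)) (AlgebraicClosure (v.adicCompletion K))) w)) := -(((hc₄u.unit⁻¹ : ((Valuation.valuationSubring (Valuation.comap (algebraMap (maxUnramified (v.adicCompletion K)) (AlgebraicClosure (v.adicCompletion K))) w)))ˣ) : (Valuation.valuationSubring (Valuation.comap (algebraMap (maxUnramified (v.adicCompletion K)) (AlgebraicClosure (v.adicCompletion K))) w))) * c) with he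
  have hc₄e : I.c₄ * e = -c := by
    rw [he, mul_neg, ← mul_assoc, IsUnit.mul_val_inv, one_mul]
  have hid : I.a₁ ^ 2 * I.c₄ + 4 * c = -I.c₆ := I.a₁_sq_mul_c₄_add_four_mul_eq_neg_c₆
  set g : ((Valuation.valuationSubring (Valuation.comap (algebraMap (maxUnramified (v.adicCompletion K)) (AlgebraicClosure (v.adicCompletion K))) w)))[X] := X ^ 2 + C I.a₁ * X + C e with hg
  have hgm : g.Monic := by
    rw [hg, add_assoc]
    exact monic_X_pow_add (lt_of_le_of_lt degree_linear_le (by decide))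
  have hgdeg : g.degree = 2 := by
    rw [hg, add_assoc, degree_add_eq_left_of_degree_lt] <;> rw [degree_X_pow]
    · rfl
    · exact lt_of_le_of_lt degree_linear_le (by decide)
  have hgdeg0 : g.degree ≠ 0 := by rw [hgdeg]; decide
  have hgeval : ∀ z : w.integer, g.eval₂ ψ z = z ^ 2 + ψ I.a₁ * z + ψ e := fun z ↦ by
    simp only [hg, eval₂_add, eval₂_mul, eval₂_X_pow, eval₂_C, eval₂_X]
  have hgder : ∀ z : w.integer, (g.map ψ).derivative.eval z = 2 * z + ψ I.a₁ := fun z ↦ by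
    simp only [hg, Polynomial.map_add, Polynomial.map_mul, Polynomial.map_pow, Polynomial.map_X,
      Polynomial.map_C, derivative_add, derivative_X_pow, derivative_mul, derivative_C,
      derivative_X, zero_mul, mul_one, zero_add, add_zero, eval_add, eval_mul, eval_C, eval_pow,
      eval_X, Nat.cast_ofNat]
    ring
  -- a root `β ∈ K̄ᵥ`; it is integral
  have hfinj : Function.Injective ((algebraMap w.integer (AlgebraicClosure (v.adicCompletion K))).comp ψ) := hvw.hom_inj.comp hψinj
  obtain ⟨β, hβ⟩ :=
    IsAlgClosed.exists_eval₂_eq_zero_of_injective ((algebraMap w.integer (AlgebraicClosure (v.adicCompletion K))).comp ψ) hfinj g hgdeg0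
  have hβ' : (g.map ψ).eval₂ (algebraMap w.integer (AlgebraicClosure (v.adicCompletion K))) β = 0 := by rwa [eval₂_map]
  have hβle : w β ≤ 1 := hvw.isIntegral_iff_v_le_one.mp ⟨g.map ψ, hgm.map ψ, hβ'⟩
  set b : w.integer := ⟨β, hβle⟩ with hb
  have hbroot : (g.map ψ).IsRoot b := by
    rw [IsRoot.def]
    apply hvw.hom_inj
    rw [map_zero, ← eval_map_apply, eval_map]
    exact hβ'
  -- `g'(β) = 2β + a₁` is a unit: `(2β + a₁)² c₄ = -c₆`
  have hbrel : b ^ 2 + ψ I.a₁ * b + ψ e = 0 := by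
    have h := hbroot
    rwa [IsRoot.def, eval_map, hgeval] at h
  have hsq : (2 * b + ψ I.a₁) ^ 2 * ψ I.c₄ = -ψ I.c₆ := by
    have H1 : ψ I.c₄ * ψ e = -ψ c := by rw [← map_mul, hc₄e, map_neg]
    have H2 : ψ I.a₁ ^ 2 * ψ I.c₄ + 4 * ψ c = -ψ I.c₆ := by
      have h := congrArg ψ hid
      simp only [map_add, map_mul, map_pow, map_neg, map_ofNat] at h
      exact h
    linear_combination (4 * ψ I.c₄) * hbrel + (-4) * H1 + H2
  have hder : IsUnit ((g.map ψ).derivative.eval b) := by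
    rw [hgder]
    have h1 : IsUnit ((2 * b + ψ I.a₁) ^ 2 * ψ I.c₄) := by rw [hsq]; exact (hc₆u.map ψ).neg
    exact (isUnit_pow_iff two_ne_zero).mp (isUnit_of_mul_isUnit_left h1)
  -- hence `β ∈ K_v^nr`, i.e. `β = ψ b'` with `b' ∈ 𝒪ⁿʳ`
  have hβnr : (β : (AlgebraicClosure (v.adicCompletion K))) ∈ (maxUnramified (v.adicCompletion K)) := mem_maxUnramified_of_isRoot_map hw hψmem g hbroot hder
  have hble : (⟨β, hβnr⟩ : (maxUnramified (v.adicCompletion K))) ∈ ((Valuation.valuationSubring (Valuation.comap (algebraMap (maxUnramified (v.adicCompletion K)) (AlgebraicClosure (v.adicCompletion K))) w))) := by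
    rw [Valuation.mem_valuationSubring_iff, comap_maxUnramified_apply]
    exact hβle
  set b' : (Valuation.valuationSubring (Valuation.comap (algebraMap (maxUnramified (v.adicCompletion K)) (AlgebraicClosure (v.adicCompletion K))) w)) := ⟨⟨β, hβnr⟩, hble⟩ with hb'
  have hψb' : ψ b' = b := Subtype.ext (by rw [hψ])
  have hroot : b' ^ 2 + I.a₁ * b' + e = 0 := by
    apply hψinj
    rw [map_add, map_add, map_mul, map_pow, hψb', map_zero]
    exact hbrel
  -- its residue is the root of the split-node quadratic
  refine ⟨residue (Valuation.valuationSubring (Valuation.comap (algebraMap (maxUnramified (v.adicCompletion K)) (AlgebraicClosure (v.adicCompletion K))) w)) b', ?_⟩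
  have key : I.c₄ * b' ^ 2 + I.a₁ * I.c₄ * b' - c = 0 := by
    linear_combination I.c₄ * hroot - hc₄e
  have key' := congrArg (residue (Valuation.valuationSubring (Valuation.comap (algebraMap (maxUnramified (v.adicCompletion K)) (AlgebraicClosure (v.adicCompletion K))) w))) key
  simp only [hc, map_sub, map_add, map_mul, map_pow, map_ofNat, map_zero] at key'
  simp only [WeierstrassCurve.map_c₄, WeierstrassCurve.map_a₁, WeierstrassCurve.map_a₂,
    WeierstrassCurve.map_b₂, WeierstrassCurve.map_b₄, WeierstrassCurve.map_b₆]
  linear_combination key'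

/-! ## The local index over `𝒪ⁿʳ` at a multiplicative place is finite -/

include hw in
set_option maxHeartbeats 1600000 in
/-- **`[J(K_v^nr) : E₀] ≠ 0` for `J = X₀ ⊗ 𝒪ⁿʳ`, `X₀` an integral Weierstrass equation over `𝓞_v`
with `Δ ∈ 𝓂_v`, `c₄ ∉ 𝓂_v`** (the integral minimal model at a multiplicative place).  Transfer of
the two conditions along the unramified `φ : 𝓞_v → 𝒪ⁿʳ` (`map_mem_maximalIdeal_iff`), the split
node over `𝒪ⁿʳ` (`exists_splitNode_root_unrIntegers`), the Tate normal form
`D • J : y² + xy = x³ + απⁿ` over the henselian `𝒪ⁿʳ` (`exists_variableChange_eq_tateNormalForm`)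
with `n ≥ 1` (`a₆ ∈ 𝔪ⁿʳ`, `a₆ ≠ 0` as `Δ ≠ 0`), and `[E(K) : E₀(K)] = n` for the normal form
(`LocalIndex.index_eq_of_tateNormalForm`, invariance `index_nonsingularReductionSubgroup_smul`):
Silverman, *ATAEC*, Cor. IV.9.2(d) — for split multiplicative reduction over a henselian discrete
valuation ring `E(K)/E₀(K)` has order `v(Δ)`.
[cite: SilvermanATAEC1994, Cor. IV.9.2(d) (PDF p. 340)] -/
theorem index_nonsingularReductionSubgroup_map_ne_zero_of_multiplicative
    [IsDiscreteValuationRing (Valuation.valuationSubring (Valuation.comap (algebraMap (maxUnramified (v.adicCompletion K)) (AlgebraicClosure (v.adicCompletion K))) w))] [HenselianLocalRing (Valuation.valuationSubring (Valuation.comap (algebraMap (maxUnramified (v.adicCompletion K)) (AlgebraicClosure (v.adicCompletion K))) w))]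
    {φ : (v.adicCompletionIntegers K) →+* (Valuation.valuationSubring (Valuation.comap (algebraMap (maxUnramified (v.adicCompletion K)) (AlgebraicClosure (v.adicCompletion K))) w))} (hφ : ∀ a, (((φ a : (Valuation.valuationSubring (Valuation.comap (algebraMap (maxUnramified (v.adicCompletion K)) (AlgebraicClosure (v.adicCompletion K))) w))) : (maxUnramified (v.adicCompletion K))) : (AlgebraicClosure (v.adicCompletion K))) = algebraMap (v.adicCompletion K) (AlgebraicClosure (v.adicCompletion K)) (a : (v.adicCompletion K)))
    (X₀ : WeierstrassCurve (v.adicCompletionIntegers K)) (hΔ0 : X₀.Δ ≠ 0) (hΔ : X₀.Δ ∈ maximalIdeal (v.adicCompletionIntegers K))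
    (hc₄ : X₀.c₄ ∉ maximalIdeal (v.adicCompletionIntegers K)) :
    letI : DecidableEq (maxUnramified (v.adicCompletion K)) := fun a b ↦ Classical.propDecidable (a = b)
    ((X₀.map φ).nonsingularReductionSubgroup (integers_valuationRing_valuation (Valuation.valuationSubring (Valuation.comap (algebraMap (maxUnramified (v.adicCompletion K)) (AlgebraicClosure (v.adicCompletion K))) w)) (maxUnramified (v.adicCompletion K)))).index
      ≠ 0 := by
  letI instDec : DecidableEq (maxUnramified (v.adicCompletion K)) := fun a b ↦ Classical.propDecidable (a = b)
  -- (1) transfer of the multiplicative conditions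
  have hΔI : (X₀.map φ).Δ ∈ maximalIdeal (Valuation.valuationSubring (Valuation.comap (algebraMap (maxUnramified (v.adicCompletion K)) (AlgebraicClosure (v.adicCompletion K))) w)) := by
    rw [WeierstrassCurve.map_Δ]; exact (map_mem_maximalIdeal_iff hw hφ _).mpr hΔ
  have hc₄I : (X₀.map φ).c₄ ∉ maximalIdeal (Valuation.valuationSubring (Valuation.comap (algebraMap (maxUnramified (v.adicCompletion K)) (AlgebraicClosure (v.adicCompletion K))) w)) := by
    rw [WeierstrassCurve.map_c₄]; exact fun h ↦ hc₄ ((map_mem_maximalIdeal_iff hw hφ _).mp h)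
  have hΔI0 : (X₀.map φ).Δ ≠ 0 := by
    rw [WeierstrassCurve.map_Δ]
    exact fun h0 ↦ hΔ0 (injective_of_coe_eq_algebraMap hφ (by rw [h0, map_zero]))
  -- (2) split node, (3) Tate normal form over the henselian `𝒪ⁿʳ`
  have hsplit := exists_splitNode_root_unrIntegers hw (X₀.map φ) hΔI hc₄I
  obtain ⟨D, h1, h2, h3, h4, h6⟩ :=
    (X₀.map φ).exists_variableChange_eq_tateNormalForm hΔI hc₄I hsplit
  set J := D • X₀.map φ with hJ
  have hJΔ : J.Δ ≠ 0 := fun h0 ↦ by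
    rw [hJ, WeierstrassCurve.variableChange_Δ, mul_eq_zero] at h0
    rcases h0 with h0 | h0
    · exact (D.u⁻¹ ^ 12).isUnit.ne_zero (by simpa only [Units.val_pow_eq_pow_val] using h0)
    · exact hΔI0 h0
  have ha0 : J.a₆ ≠ 0 := fun h0 ↦ by
    apply hJΔ
    rw [J.Δ_eq_of_tateNormalForm h1 h2 h3 h4, h0, zero_mul, neg_zero]
  obtain ⟨ϖ, hϖ⟩ := IsDiscreteValuationRing.exists_irreducible (Valuation.valuationSubring (Valuation.comap (algebraMap (maxUnramified (v.adicCompletion K)) (AlgebraicClosure (v.adicCompletion K))) w))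
  obtain ⟨n, α, hα⟩ := IsDiscreteValuationRing.eq_unit_mul_pow_irreducible ha0 hϖ
  have hn1 : 1 ≤ n := by
    rcases Nat.eq_zero_or_pos n with h0 | hpos
    · exfalso
      rw [h0, pow_zero, mul_one] at hα
      rw [hα] at h6
      exact (IsLocalRing.mem_maximalIdeal _).mp h6 α.isUnit
    · exact hpos
  -- the index of the normal form is `n`, and it is that of `J`
  have key := LocalIndex.index_eq_of_tateNormalForm (K := (maxUnramified (v.adicCompletion K))) J hϖ h1 h2 h3 h4 α.isUnit hn1 hα
  rw [hJ, index_nonsingularReductionSubgroup_smul] at key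
  rw [key]
  omega

/-! ## Kodaira–Néron over `K_v^nr` at the multiplicative places -/

set_option maxHeartbeats 4000000 in
/-- **Kodaira–Néron finiteness over `K_v^nr` for multiplicative reduction** — the named fact
`WeierstrassCurve.kodairaNeron_exists_finset_reducesToNonsingular` of `KodairaNeronUnramified`
(Silverman, *AEC*, Cor. VII.6.2 as applied over `K^nr` in the proof of Thm. VII.7.1: "the quotient
group `E(K^nr)/E₀(K^nr)` is finite"; *ATAEC* Cor. IV.9.2(d)) **for every elliptic curve over `K_v`
given by a minimal Weierstrass equation `X` with multiplicative reduction** (Mathlib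
`HasMultiplicativeReduction 𝓞_v`, split or non-split).

Proof.  (1) *The local index over `𝒪ⁿʳ` is finite*: for the integral model `X₀` of `X` one has
`Δ(X₀) ∈ 𝓂_v ∌ c₄(X₀)`, so `[J(K_v^nr) : E₀] = n = v(Δ) ≠ 0` for `J = X₀ ⊗ 𝒪ⁿʳ`
(`index_nonsingularReductionSubgroup_map_ne_zero_of_multiplicative`: over `K_v^nr` the node is
split and `𝒪ⁿʳ` is henselian, so `J` has a Tate normal form `y² + xy = x³ + απⁿ`, whose index is
`n` by `KodairaNeronSplitHenselianProofs`).  (2)–(4) *Representatives, fixed points, `E₀`*: exactly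
as in `kodairaNeron_exists_finset_reducesToNonsingular_of_hasAdditiveReductionAt`
(`KodairaNeronAdditiveProofs`): the finitely many classes of `J(K_v^nr)/E₀` have representatives,
pushed into `X(K̄_v)` along `J ⊗ K_v^nr = X ⊗ K_v^nr ⊆ X ⊗ K̄_v`, with coordinates in `K_v^nr`,
the fixed field of `I_𝔐` (`mem_maxUnramified_iff_forall_inertia`); the `I_𝔐`-fixed points of
`X(K̄_v)` come from `X(K_v^nr)`; and a point of `J(K_v^nr)` with nonsingular reduction has
`Literature.NumberTheory.EllipticCurves.ReducesToNonsingular` for `|·|_v` (bridge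
`reducesToNonsingular_iff_hasNonsingularReduction` on the `𝒪_w`-model `J ⊗ 𝒪_w`, the residue
field of `𝒪ⁿʳ` embedding into that of `𝒪_w`).
[cite: SilvermanAEC2009, Cor. VII.6.2 with Thm. VII.6.1, as applied over `K^nr` in the proof of Thm. VII.7.1 (PDF pp. 177–179)]
[cite: SilvermanATAEC1994, Cor. IV.9.2(d) (PDF p. 340)] -/
theorem _root_.WeierstrassCurve.kodairaNeron_exists_finset_reducesToNonsingular_of_hasMultiplicativeReduction
    (X : WeierstrassCurve (v.adicCompletion K)) (hmult : X.HasMultiplicativeReduction (v.adicCompletionIntegers K)) :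
    X.kodairaNeron_exists_finset_reducesToNonsingular := by
  intro hXell _ w hw 𝔐 h𝔐
  -- the classical decidable equality on `K_v^nr`, as in the index theorems of the tree
  letI instDec : DecidableEq (maxUnramified (v.adicCompletion K)) := fun a b => Classical.propDecidable (a = b)
  haveI := isDiscreteValuationRing_unrIntegers hw
  haveI := henselianLocalRing_unrIntegers hw
  obtain ⟨φ, hφ⟩ := exists_ringHom_adicCompletionIntegers_unrIntegers hw
  obtain ⟨ψ, hψ⟩ := exists_ringHom_unrIntegers_integer (w := w)
  have hvR := integers_valuationRing_valuation (Valuation.valuationSubring (Valuation.comap (algebraMap (maxUnramified (v.adicCompletion K)) (AlgebraicClosure (v.adicCompletion K))) w)) (maxUnramified (v.adicCompletion K))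
  have hinjR := IsFractionRing.injective (Valuation.valuationSubring (Valuation.comap (algebraMap (maxUnramified (v.adicCompletion K)) (AlgebraicClosure (v.adicCompletion K))) w)) (maxUnramified (v.adicCompletion K))
  have hX₀K : (X.integralModel (v.adicCompletionIntegers K)).baseChange (v.adicCompletion K) = X :=
    WeierstrassCurve.baseChange_integralModel_eq (v.adicCompletionIntegers K) X
  have hΔ : (X.integralModel (v.adicCompletionIntegers K)).Δ ≠ 0 := fun h0 ↦ by
    have : X.Δ = 0 := by
      rw [← hX₀K]
      change ((X.integralModel (v.adicCompletionIntegers K)).map (algebraMap _ _)).Δ = 0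
      rw [WeierstrassCurve.map_Δ, h0, map_zero]
    exact hXell.isUnit.ne_zero this
  -- multiplicative reduction of the minimal `X`: `Δ(X₀) ∈ 𝓂_v`, `c₄(X₀) ∉ 𝓂_v`
  have hΔm : (X.integralModel (v.adicCompletionIntegers K)).Δ ∈ maximalIdeal (v.adicCompletionIntegers K) := by
    have h := hmult.badReduction
    rw [← WeierstrassCurve.integralModel_Δ_eq (v.adicCompletionIntegers K) X] at h
    exact (valuation_lt_one_iff_mem _ _).mp h
  have hc₄m : (X.integralModel (v.adicCompletionIntegers K)).c₄ ∉ maximalIdeal (v.adicCompletionIntegers K) := by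
    have h := hmult.multiplicativeReduction
    rw [← WeierstrassCurve.integralModel_c₄_eq (v.adicCompletionIntegers K) X, valuation_of_algebraMap] at h
    exact intValuation_eq_one_iff.mp h
  /- (1) the index of `E₀` in `J(K_v^nr)`, `J = X₀ ⊗ 𝒪ⁿʳ`, is finite -/
  have hfin : (((X.integralModel (v.adicCompletionIntegers K)).map φ).nonsingularReductionSubgroup hvR).index ≠ 0 :=
    index_nonsingularReductionSubgroup_map_ne_zero_of_multiplicative hw hφ _ hΔ hΔm hc₄m
  /- the model `J = X₀ ⊗ 𝒪ⁿʳ`, its base changes to `K_v^nr` and to `𝒪_w`, `K̄_v` -/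
  have hJ : ((X.integralModel (v.adicCompletionIntegers K)).map φ).baseChange (maxUnramified (v.adicCompletion K)) = X.baseChange (maxUnramified (v.adicCompletion K)) := by
    conv_rhs => rw [← hX₀K]
    change ((X.integralModel (v.adicCompletionIntegers K)).map φ).map (algebraMap _ _) =
      ((X.integralModel (v.adicCompletionIntegers K)).map (algebraMap (v.adicCompletionIntegers K) (v.adicCompletion K))).map (algebraMap (v.adicCompletion K) (maxUnramified (v.adicCompletion K)))
    rw [WeierstrassCurve.map_map, WeierstrassCurve.map_map]
    congr 1
    refine RingHom.ext fun a ↦ Subtype.ext ?_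
    change (((φ a : (Valuation.valuationSubring (Valuation.comap (algebraMap (maxUnramified (v.adicCompletion K)) (AlgebraicClosure (v.adicCompletion K))) w))) : (maxUnramified (v.adicCompletion K))) : (AlgebraicClosure (v.adicCompletion K))) = ((algebraMap (v.adicCompletion K) (maxUnramified (v.adicCompletion K)) (algebraMap (v.adicCompletionIntegers K) (v.adicCompletion K) a) : (maxUnramified (v.adicCompletion K))) : (AlgebraicClosure (v.adicCompletion K)))
    rw [hφ, IntermediateField.coe_algebraMap_apply]
    rfl
  have hW₀ : (((X.integralModel (v.adicCompletionIntegers K)).map φ).map ψ).baseChange (AlgebraicClosure (v.adicCompletion K)) = X.baseChange (AlgebraicClosure (v.adicCompletion K)) := by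
    conv_rhs => rw [← hX₀K]
    change (((X.integralModel (v.adicCompletionIntegers K)).map φ).map ψ).map (algebraMap _ _) =
      ((X.integralModel (v.adicCompletionIntegers K)).map (algebraMap (v.adicCompletionIntegers K) (v.adicCompletion K))).map (algebraMap (v.adicCompletion K) (AlgebraicClosure (v.adicCompletion K)))
    rw [WeierstrassCurve.map_map, WeierstrassCurve.map_map, WeierstrassCurve.map_map]
    congr 1
    refine RingHom.ext fun a ↦ ?_
    change ((ψ (φ a) : w.integer) : (AlgebraicClosure (v.adicCompletion K))) = algebraMap (v.adicCompletion K) (AlgebraicClosure (v.adicCompletion K)) (algebraMap (v.adicCompletionIntegers K) (v.adicCompletion K) a)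
    rw [hψ, hφ]
    rfl
  -- the residue field of `𝒪ⁿʳ` embeds into that of `𝒪_w`
  haveI hψloc : IsLocalHom ψ := ⟨fun a ha ↦ by
    by_contra hna
    have hmem : a ∈ maximalIdeal (Valuation.valuationSubring (Valuation.comap (algebraMap (maxUnramified (v.adicCompletion K)) (AlgebraicClosure (v.adicCompletion K))) w)) :=
      (IsLocalRing.mem_maximalIdeal _).mpr (mem_nonunits_iff.mpr hna)
    have := (map_mem_maximalIdeal_integer_iff hψ a).mpr hmem
    exact (mem_nonunits_iff.mp ((IsLocalRing.mem_maximalIdeal _).mp this)) ha⟩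
  have hκ : (((X.integralModel (v.adicCompletionIntegers K)).map φ).map ψ).map (residue w.integer) =
      ((((X.integralModel (v.adicCompletionIntegers K)).map φ).map (residue (Valuation.valuationSubring (Valuation.comap (algebraMap (maxUnramified (v.adicCompletion K)) (AlgebraicClosure (v.adicCompletion K))) w)))).map
        (IsLocalRing.ResidueField.map ψ)) := by
    simp only [WeierstrassCurve.map_map]
    congr 1
  /- the maps on points: `J(K_v^nr) ≃ X(K_v^nr) → X(K̄_v)` -/
  set e₁ := WeierstrassCurve.Affine.Point.congrEquiv hJ with he₁
  set ι : (X.baseChange (maxUnramified (v.adicCompletion K))).toAffine.Point →+ (X.baseChange (AlgebraicClosure (v.adicCompletion K))).toAffine.Point :=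
    WeierstrassCurve.Affine.Point.map (W' := X)
      (IsScalarTower.toAlgHom (v.adicCompletion K) (maxUnramified (v.adicCompletion K)) (AlgebraicClosure (v.adicCompletion K))) with hι
  -- (2) images of `K_v^nr`-points are fixed by `I_𝔐`
  have hfixι : ∀ (Q : (X.baseChange (maxUnramified (v.adicCompletion K))).toAffine.Point),
      ∀ σ ∈ 𝔐.inertia (absoluteGaloisGroup (v.adicCompletion K)),
        WeierstrassCurve.Affine.Point.map
          ((absoluteGaloisGroup.toAlgEquiv _ σ : (AlgebraicClosure (v.adicCompletion K)) ≃ₐ[(v.adicCompletion K)] (AlgebraicClosure (v.adicCompletion K))) : (AlgebraicClosure (v.adicCompletion K)) →ₐ[(v.adicCompletion K)] (AlgebraicClosure (v.adicCompletion K))) (ι Q) = ι Q := by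
    intro Q σ hσ
    rcases Q with _ | ⟨x, y, h⟩
    · rfl
    · change WeierstrassCurve.Affine.Point.map _ (WeierstrassCurve.Affine.Point.some _ _ _) =
        WeierstrassCurve.Affine.Point.some _ _ _
      rw [WeierstrassCurve.Affine.Point.map_some]
      exact point_some_congr (smul_coe_maxUnramified hw h𝔐 x hσ)
        (smul_coe_maxUnramified hw h𝔐 y hσ)
  -- (3) `I_𝔐`-fixed points of `X(K̄_v)` come from `X(K_v^nr)`
  have hsurj : ∀ P : (X.baseChange (AlgebraicClosure (v.adicCompletion K))).toAffine.Point,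
      (∀ σ ∈ 𝔐.inertia (absoluteGaloisGroup (v.adicCompletion K)),
        WeierstrassCurve.Affine.Point.map
          ((absoluteGaloisGroup.toAlgEquiv _ σ : (AlgebraicClosure (v.adicCompletion K)) ≃ₐ[(v.adicCompletion K)] (AlgebraicClosure (v.adicCompletion K))) : (AlgebraicClosure (v.adicCompletion K)) →ₐ[(v.adicCompletion K)] (AlgebraicClosure (v.adicCompletion K))) P = P) →
        ∃ Q, ι Q = P := by
    intro P hP
    rcases P with _ | ⟨x, y, h⟩
    · exact ⟨0, map_zero ι⟩
    · have hx : x ∈ (maxUnramified (v.adicCompletion K)) := (mem_maxUnramified_iff_forall_inertia hw h𝔐).mpr fun σ hσ ↦ by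
        have := hP σ hσ
        rw [WeierstrassCurve.Affine.Point.map_some, WeierstrassCurve.Affine.Point.some.injEq] at this
        exact this.1
      have hy : y ∈ (maxUnramified (v.adicCompletion K)) := (mem_maxUnramified_iff_forall_inertia hw h𝔐).mpr fun σ hσ ↦ by
        have := hP σ hσ
        rw [WeierstrassCurve.Affine.Point.map_some, WeierstrassCurve.Affine.Point.some.injEq] at this
        exact this.2
      have hinjι : Function.Injective (IsScalarTower.toAlgHom (v.adicCompletion K) (maxUnramified (v.adicCompletion K)) (AlgebraicClosure (v.adicCompletion K))) :=
        fun a b hab ↦ Subtype.ext hab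
      have h₀ : (X.baseChange (maxUnramified (v.adicCompletion K))).toAffine.Nonsingular ⟨x, hx⟩ ⟨y, hy⟩ :=
        (WeierstrassCurve.Affine.baseChange_nonsingular (W := X)
          (f := IsScalarTower.toAlgHom (v.adicCompletion K) (maxUnramified (v.adicCompletion K)) (AlgebraicClosure (v.adicCompletion K))) hinjι ⟨x, hx⟩ ⟨y, hy⟩).mp h
      exact ⟨.some _ _ h₀, rfl⟩
  -- (4) `E₀` of `J` over `𝒪ⁿʳ` maps into `E₀` of `X` over `𝒪_w`
  have hE₀ : ∀ Q : (((X.integralModel (v.adicCompletionIntegers K)).map φ).baseChange (maxUnramified (v.adicCompletion K))).toAffine.Point,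
      ((X.integralModel (v.adicCompletionIntegers K)).map φ).HasNonsingularReduction Q →
        ReducesToNonsingular w (residue w.integer) (ι (e₁ Q)) := by
    intro Q hQ
    rcases point_cases hvR Q with rfl | ⟨x, y, h, rfl, hx⟩ | ⟨a, b, h, rfl⟩
    · rw [map_zero, map_zero]
      exact reducesToNonsingular_zero
    · have hx' : 1 < w (x : (AlgebraicClosure (v.adicCompletion K))) := not_le.mp fun hle ↦
        (not_mem_range_iff hvR).mpr hx ⟨⟨x, (Valuation.mem_valuationSubring_iff _ _).mpr hle⟩, rfl⟩
      rw [he₁, WeierstrassCurve.Affine.Point.congrEquiv_some]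
      exact reducesToNonsingular_of_one_lt hx'
    · have hns := (WeierstrassCurve.hasNonsingularReduction_some_algebraMap_iff hinjR h).mp hQ
      rw [he₁, WeierstrassCurve.Affine.Point.congrEquiv_some]
      -- transport to the `𝒪_w`-model `J ⊗ 𝒪_w` of `X ⊗ K̄ᵥ`
      rw [← (WeierstrassCurve.Affine.Point.congrEquiv hW₀).apply_symm_apply (ι _),
        reducesToNonsingular_congrEquiv_iff, reducesToNonsingular_iff_hasNonsingularReduction]
      change (((X.integralModel (v.adicCompletionIntegers K)).map φ).map ψ).HasNonsingularReduction
        ((WeierstrassCurve.Affine.Point.congrEquiv hW₀).symm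
          (WeierstrassCurve.Affine.Point.some _ _ _))
      rw [WeierstrassCurve.Affine.Point.congrEquiv_symm_some]
      refine Or.inr ⟨ψ a, ψ b, hψ a, hψ b, ?_⟩
      rw [hκ, ← IsLocalRing.ResidueField.map_residue, ← IsLocalRing.ResidueField.map_residue]
      exact (WeierstrassCurve.Affine.map_nonsingular _
        (IsLocalRing.ResidueField.map ψ).injective _ _).mpr hns
  /- representatives -/
  haveI := AddSubgroup.fintypeOfIndexNeZero hfin
  set H := ((X.integralModel (v.adicCompletionIntegers K)).map φ).nonsingularReductionSubgroup hvR with hH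
  refine ⟨(Finset.univ.image fun q :
      (((X.integralModel (v.adicCompletionIntegers K)).map φ).baseChange (maxUnramified (v.adicCompletion K))).toAffine.Point ⧸ H ↦
        ι (e₁ (Quotient.out q))), ?_, ?_⟩
  · intro t ht σ hσ
    obtain ⟨q, -, rfl⟩ := Finset.mem_image.mp ht
    exact hfixι _ σ hσ
  · intro P hP
    obtain ⟨P₀, rfl⟩ := hsurj P hP
    set Q₀ := e₁.symm P₀ with hQ₀
    obtain ⟨h, hh⟩ := QuotientAddGroup.mk_out_eq_mul H Q₀
    refine ⟨ι (e₁ (Quotient.out (Q₀ : _ ⧸ H))), Finset.mem_image_of_mem _ (Finset.mem_univ _), ?_⟩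
    have hP₀ : ι P₀ = ι (e₁ Q₀) := by rw [hQ₀, AddEquiv.apply_symm_apply]
    rw [hP₀, ← map_sub, ← map_sub]
    apply hE₀
    rw [hh, sub_add_cancel_left]
    exact (H.neg_mem h.2 : _)

/-- **Kodaira–Néron over `K_v^nr` at the multiplicative places of an elliptic curve over a number
field**: the named fact `kodairaNeron_exists_finset_reducesToNonsingular` for the minimal model
`W.localMinimalModel v` of an elliptic curve `E/K` at a place `v` of multiplicative reduction
(`W.HasMultiplicativeReductionAt v`, which is `HasMultiplicativeReduction 𝓞_v` of that model) — the
form consumed by `smul_nsmul_torsion_of_hasMultiplicativeReductionAt_of_kodairaNeron_at`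
(`HasseWeilAbelianEulerFactorKodairaNeronProofs`).  Silverman, *AEC*, Cor. VII.6.2 / Thm. VII.6.1;
*ATAEC* Cor. IV.9.2(d).
[cite: SilvermanAEC2009, Cor. VII.6.2, as applied over `K^nr` in the proof of Thm. VII.7.1 (PDF pp. 177–179)] -/
theorem _root_.WeierstrassCurve.kodairaNeron_exists_finset_reducesToNonsingular_of_hasMultiplicativeReductionAt
    (W : WeierstrassCurve K) (hmult : W.HasMultiplicativeReductionAt v) :
    (W.localMinimalModel v).kodairaNeron_exists_finset_reducesToNonsingular :=
  (W.localMinimalModel v).kodairaNeron_exists_finset_reducesToNonsingular_of_hasMultiplicativeReduction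
    hmult

end IsDedekindDomain.HeightOneSpectrum

end
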